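import Mathlib
import HarnessLib
import Literature.MathematicalPhysics.QuantumFieldTheory.ConstructiveQFTWave0
import Literature.Barriers.QuantumFields.ElitzurTheorem
import Summits.QuantumFields.GaugeBoot.LatticeWords
import Summits.Ventures.LatticeQCDFlow.Exactness.LatticeCoordAvg
import Summits.Ventures.LatticeQCDFlow.Scaling.AutoregressiveGaugeRedundancy
import Summits.Ventures.LatticeQCDFlow.Scaling.GaugeForestTrivial
import Summits.Ventures.LatticeQCDFlow.Scaling.GaugeCycleHolonomy
import Summits.Ventures.LatticeQCDFlow.Scaling.GaugeCycleTheta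

/-!
# LatticeQCDFlow / Scaling — gauge classes on ANY connected link set are the simultaneous conjugacy
# classes of its based loop holonomies (the full classification, by path-ordered transport); the
# partial Haar marginal over a connected retained set is a function of that joint class

HONEST FRAMING: exact (Metropolis-corrected) sampling algorithms for lattice gauge theory;
figures of merit are autocorrelation/cost numbers at stated couplings and volumes; no
continuum-physics claim.

Venture `LatticeQCDFlow` (cell pub-lqcd), topic `Scaling`, FANOUT row 30 (lean-1, GEN-16) — OUR WORK,
the capstone of the configuration-level series `Scaling/GaugeCycleHolonomy` (covariance, ear lemma,
one cycle), `Scaling/GaugeCycleForests` (forests, bouquets), `Scaling/GaugeCycleTheta` (theta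
graphs): there the invariant was computed for explicitly decomposed link sets; here it is stated for
an ARBITRARY link set `S` connected to a base site `x₀` (every endpoint of every link of `S` is reached
from `x₀` by a word running inside `S`), every group `G`, every `d`, `L`:

* §1 `zipWith_edge_reverse` — the reversed word traverses the same links (in reverse order).
* §2 **`gaugeRelated_on_iff_loops`** — two configurations are gauge related on `S` iff ONE `k`
  conjugates the holonomies of ALL closed words from `x₀` running inside `S`:
  `hol_w(U') = k · hol_w(U) · k⁻¹`.  Necessity is covariance; sufficiency is PATH-ORDERED TRANSPORT:
  choose for every reachable site `v` a word `p_v` inside `S` and put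
  `γ(v) = hol_{p_v}(U')⁻¹ · k · hol_{p_v}(U)`; the link `e = (x, μ)` then matches because the closed
  word `p_x · e · p_{x+e_μ}⁻¹` runs inside `S` (Giles' reconstruction, lattice form).  So the gauge
  classes of configurations restricted to a connected link set ARE the simultaneous conjugacy classes
  of the holonomy representation of its based loops — the explicit finite criteria of the sister
  files (one cycle; a bouquet; a theta graph) are the cases where finitely many loops generate.
* §3 THE WHOLE TORUS (`L ≠ 0`): `exists_word_endpoint` (every site is reached from every other by a
  word), **`gaugeRelated_iff_loops_univ`**, **`eq_of_isGaugeInvariant_of_loops_conj`** — BASED WILSON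
  LOOPS ARE COMPLETE GAUGE INVARIANTS on the finite torus (lattice form of Giles' reconstruction):
  a gauge-invariant observable takes the same value on configurations whose based loop holonomies are
  simultaneously conjugate.
* §4 **`coordAvg_connected_classFunction`** (measure level, over `Scaling/AutoregressiveGaugeRedundancy`
  §4): if the links off `s` lie in such an `S`, then for every gauge-invariant weight `F` the partial
  Haar marginal `A_s F` takes the same value on any two configurations whose based `S`-loop holonomies
  are simultaneously conjugate — THE EXACT AUTOREGRESSIVE CONTEXT OF A GAUGE THEORY IN LINK VARIABLES
  IS, AT MOST, THE JOINT CONJUGACY CLASS OF THE HOLONOMIES OF THE RETAINED LOOPS (per connected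
  component of the retained set; vertex-disjoint parts glue: `exists_gaugeTransform_union_of_disjoint`).

NOT CLAIMED: any lower bound; a finite generating set of loops for a general `S` (fundamental cycles
of a spanning tree — not needed for the statements here); any number of ours.  Nearest prints:
R. Giles, Phys. Rev. D 24 (1981) 2160 (reconstruction of gauge potentials from Wilson loops); gauge
orbits on a finite graph `= G^E/G^V ≅ Hom(π₁, G)/Ad G` (J. Baez, Adv. Math. 117 (1996) 253 §2;
Gambini–Pullin 1996 Ch. 1) — the coordinate-average (exact conditional) reading is ours.  No
definition is introduced; nothing is cited as a fact; no `sorry`.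
-/

noncomputable section

namespace Summit.Ventures.LatticeQCDFlow.Theory2.Autoregressive

open MeasureTheory Function
open Literature.MathematicalPhysics.QuantumFieldTheory
open Summit.Ventures.LatticeQCDFlow.Exactness
open Summit.QuantumFields.GaugeBoot

variable {d L : ℕ} {G : Type*} [Group G]

/-! ## §1 The reversed word traverses the same links -/

/-- The links traversed by the reversed word, read from the endpoint, are the links of the word in
reverse order. [ours] -/
theorem zipWith_edge_reverse :
    ∀ (x : Site d L) (w : Word d),
      List.zipWith Step.edge ((Word.reverse w).scanl Step.apply (Word.endpoint x w)) (Word.reverse w) =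
        (List.zipWith Step.edge (w.scanl Step.apply x) w).reverse
  | x, [] => by simp
  | x, s :: w => by
    rw [Word.reverse_cons, Word.endpoint_cons, zipWith_edge_append, zipWith_edge_reverse (s.apply x) w,
      Word.endpoint_reverse, zipWith_edge_cons x s w, List.reverse_cons]
    simp [List.scanl_cons]

/-- Hence a link is traversed by the reversed word iff it is traversed by the word. [ours] -/
theorem mem_zipWith_edge_reverse_iff (x : Site d L) (w : Word d) (e : Edge d L) :
    e ∈ List.zipWith Step.edge ((Word.reverse w).scanl Step.apply (Word.endpoint x w)) (Word.reverse w) ↔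
      e ∈ List.zipWith Step.edge (w.scanl Step.apply x) w := by
  rw [zipWith_edge_reverse, List.mem_reverse]

/-! ## §2 Gauge classes on a connected link set = simultaneous conjugacy classes of based loops -/

/-- **GAUGE CLASSES ON A CONNECTED LINK SET ARE THE SIMULTANEOUS CONJUGACY CLASSES OF ITS BASED LOOP
HOLONOMIES.**  Let every endpoint of every link of `S` be reachable from `x₀` by a word whose links
lie in `S`.  Then `U` and `U'` are gauge related on `S` iff ONE `k` conjugates `hol_w(U)` into
`hol_w(U')` for EVERY closed word `w` from `x₀` whose links lie in `S`. [ours] -/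
theorem gaugeRelated_on_iff_loops (S : Set (Edge d L)) (x₀ : Site d L)
    (hconn : ∀ e ∈ S, ∀ v, v = e.1 ∨ v = e.1.shift e.2 →
      ∃ w : Word d, Word.endpoint x₀ w = v ∧
        ∀ l ∈ List.zipWith Step.edge (w.scanl Step.apply x₀) w, l ∈ S)
    (U U' : GaugeConfig d L G) :
    (∃ γ : Site d L → G, ∀ e ∈ S, gaugeTransform γ U e = U' e) ↔
      ∃ k : G, ∀ w : Word d, Word.endpoint x₀ w = x₀ →
        (∀ l ∈ List.zipWith Step.edge (w.scanl Step.apply x₀) w, l ∈ S) →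
          wordHolonomy U' x₀ w = k * wordHolonomy U x₀ w * k⁻¹ := by
  classical
  constructor
  · rintro ⟨γ, hγ⟩
    exact ⟨γ x₀, fun w hw hS => wordHolonomy_eq_conj_of_eqOn hw fun e he => hγ e (hS e he)⟩
  · rintro ⟨k, hk⟩
    -- path-ordered transport: `γ(v) = hol_{p_v}(U')⁻¹ · k · hol_{p_v}(U)` along a chosen word to `v`
    let P : Site d L → Prop := fun v => ∃ w : Word d, Word.endpoint x₀ w = v ∧
      ∀ l ∈ List.zipWith Step.edge (w.scanl Step.apply x₀) w, l ∈ S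
    let γ : Site d L → G := fun v =>
      if h : P v then (wordHolonomy U' x₀ (Classical.choose h))⁻¹ * k *
        wordHolonomy U x₀ (Classical.choose h) else 1
    refine ⟨γ, fun e he => ?_⟩
    obtain ⟨x, μ⟩ := e
    have hPx : P x := hconn _ he x (Or.inl rfl)
    have hPy : P (x.shift μ) := hconn _ he (x.shift μ) (Or.inr rfl)
    set p := Classical.choose hPx with hp
    set q := Classical.choose hPy with hq
    obtain ⟨hpend, hpS⟩ := Classical.choose_spec hPx
    obtain ⟨hqend, hqS⟩ := Classical.choose_spec hPy
    rw [← hp] at hpend hpS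
    rw [← hq] at hqend hqS
    have hγx : γ x = (wordHolonomy U' x₀ p)⁻¹ * k * wordHolonomy U x₀ p := by
      simp only [γ, dif_pos hPx, hp]
    have hγy : γ (x.shift μ) = (wordHolonomy U' x₀ q)⁻¹ * k * wordHolonomy U x₀ q := by
      simp only [γ, dif_pos hPy, hq]
    -- the closed word `p · (+e_μ) · q⁻¹` runs inside `S`
    let W : Word d := p ++ [Step.fwd μ] ++ Word.reverse q
    have hWend : Word.endpoint x₀ W = x₀ := by
      simp only [W, Word.endpoint_append, hpend, Word.endpoint_cons, Word.endpoint_nil,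
        Step.apply_fwd]
      rw [← hqend, Word.endpoint_reverse]
    have hWS : ∀ l ∈ List.zipWith Step.edge (W.scanl Step.apply x₀) W, l ∈ S := by
      intro l hl
      simp only [W] at hl
      rw [zipWith_edge_append, List.mem_append, zipWith_edge_append, List.mem_append,
        Word.endpoint_append, hpend] at hl
      rcases hl with (hl | hl) | hl
      · exact hpS l hl
      · simp [List.scanl_cons] at hl
        rw [hl]; exact he
      · rw [Word.endpoint_cons, Word.endpoint_nil, Step.apply_fwd, ← hqend,
          mem_zipWith_edge_reverse_iff] at hl
        exact hqS l hl
    have hWhol : ∀ V : GaugeConfig d L G, wordHolonomy V x₀ W =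
        wordHolonomy V x₀ p * V (x, μ) * (wordHolonomy V x₀ q)⁻¹ := by
      intro V
      simp only [W, wordHolonomy_append, hpend, wordHolonomy_cons, wordHolonomy_nil,
        stepHolonomy_fwd, Word.endpoint_append, Word.endpoint_cons, Word.endpoint_nil, Step.apply_fwd,
        mul_one]
      rw [← hqend, wordHolonomy_reverse]
    have hkW := hk W hWend hWS
    rw [hWhol, hWhol] at hkW
    -- solve for `U' (x, μ)`
    show γ x * U (x, μ) * (γ ((x, μ).1.shift (x, μ).2))⁻¹ = U' (x, μ)
    simp only
    rw [hγx, hγy]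
    calc (wordHolonomy U' x₀ p)⁻¹ * k * wordHolonomy U x₀ p * U (x, μ) *
          ((wordHolonomy U' x₀ q)⁻¹ * k * wordHolonomy U x₀ q)⁻¹
        = (wordHolonomy U' x₀ p)⁻¹ *
            (k * (wordHolonomy U x₀ p * U (x, μ) * (wordHolonomy U x₀ q)⁻¹) * k⁻¹) *
            wordHolonomy U' x₀ q := by group
      _ = U' (x, μ) := by rw [← hkW]; group

/-- **Vertex-disjoint parts glue**: if `γ₁` maps `U` to `U'` on `S₁`, `γ₂` on `S₂`, and no site is
an endpoint of both an `S₁`-link and an `S₂`-link, then one gauge transformation does both (take `γ₁`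
at the endpoints of `S₁`-links and `γ₂` elsewhere).  So the classification of §2 applies component
by component, with independent conjugators. [ours] -/
theorem exists_gaugeTransform_union_of_disjoint (S₁ S₂ : Set (Edge d L))
    (hdisj : ∀ e₁ ∈ S₁, ∀ e₂ ∈ S₂, ∀ v, (v = e₁.1 ∨ v = e₁.1.shift e₁.2) →
      ¬ (v = e₂.1 ∨ v = e₂.1.shift e₂.2))
    {U U' : GaugeConfig d L G} {γ₁ γ₂ : Site d L → G}
    (h₁ : ∀ e ∈ S₁, gaugeTransform γ₁ U e = U' e) (h₂ : ∀ e ∈ S₂, gaugeTransform γ₂ U e = U' e) :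
    ∃ γ : Site d L → G, (∀ e ∈ S₁, gaugeTransform γ U e = U' e) ∧
      ∀ e ∈ S₂, gaugeTransform γ U e = U' e := by
  classical
  let P : Site d L → Prop := fun v => ∃ e ∈ S₁, v = e.1 ∨ v = e.1.shift e.2
  refine ⟨fun v => if P v then γ₁ v else γ₂ v, fun e he => ?_, fun e he => ?_⟩
  · have h1 : P e.1 := ⟨e, he, Or.inl rfl⟩
    have h2 : P (e.1.shift e.2) := ⟨e, he, Or.inr rfl⟩
    rw [gaugeTransform_congr_endpoints U (γ' := γ₁) (if_pos h1) (if_pos h2)]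
    exact h₁ e he
  · have h1 : ¬ P e.1 := fun ⟨e₁, he₁, hv⟩ => hdisj e₁ he₁ e he _ hv (Or.inl rfl)
    have h2 : ¬ P (e.1.shift e.2) := fun ⟨e₁, he₁, hv⟩ => hdisj e₁ he₁ e he _ hv (Or.inr rfl)
    rw [gaugeTransform_congr_endpoints U (γ' := γ₂) (if_neg h1) (if_neg h2)]
    exact h₂ e he

/-! ## §3 The whole torus: based Wilson loops are complete gauge invariants (Giles, lattice form) -/

/-- Walking `n` forward steps along the axis `i` from `y` ends at `y + n·e_i`. [ours] -/
theorem endpoint_replicate_fwd (y : Site d L) (i : Fin d) :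
    ∀ n : ℕ, Word.endpoint y (List.replicate n (Step.fwd i)) = y + Pi.single i (n : ZMod L)
  | 0 => by simp
  | n + 1 => by
    rw [List.replicate_succ, Word.endpoint_cons, Step.apply_fwd, Site.shift,
      endpoint_replicate_fwd (y + Pi.single i 1) i n, add_assoc, ← Pi.single_add, Nat.cast_succ,
      add_comm (1 : ZMod L)]

/-- Axis by axis: the word `∏_{i ∈ l} (+e_i)^{n_i}` from `y` ends at `y + Σ_{i ∈ l} n_i·e_i`. [ours] -/
theorem endpoint_flatMap_replicate (n : Fin d → ℕ) :
    ∀ (l : List (Fin d)) (y : Site d L),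
      Word.endpoint y (l.flatMap fun i => List.replicate (n i) (Step.fwd i)) =
        y + (l.map fun i => (Pi.single i ((n i : ℕ) : ZMod L) : Site d L)).sum
  | [], y => by simp
  | i :: l, y => by
    rw [List.flatMap_cons, Word.endpoint_append, endpoint_replicate_fwd,
      endpoint_flatMap_replicate n l, List.map_cons, List.sum_cons, add_assoc]

/-- **Every site of the torus is reached from every other by a lattice word** (`L ≠ 0`). [ours] -/
theorem exists_word_endpoint [NeZero L] (x₀ v : Site d L) :
    ∃ w : Word d, Word.endpoint x₀ w = v := by
  refine ⟨(List.finRange d).flatMap fun i => List.replicate ((v - x₀) i).val (Step.fwd i), ?_⟩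
  rw [endpoint_flatMap_replicate]
  have : ((List.finRange d).map fun i => (Pi.single i ((((v - x₀) i).val : ℕ) : ZMod L) :
      Site d L)).sum = v - x₀ := by
    rw [← Fin.sum_univ_def]
    simp only [ZMod.natCast_zmod_val]
    exact Finset.univ_sum_single (v - x₀)
  rw [this, add_sub_cancel]

/-- **GAUGE CLASSES OF THE WHOLE TORUS = SIMULTANEOUS CONJUGACY CLASSES OF ALL BASED LOOP
HOLONOMIES** (`L ≠ 0`): `U'` is a gauge transform of `U` iff one `k` conjugates `hol_w(U)` into
`hol_w(U')` for every closed word `w` from `x₀`. [ours] -/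
theorem gaugeRelated_iff_loops_univ [NeZero L] (x₀ : Site d L) (U U' : GaugeConfig d L G) :
    (∃ γ : Site d L → G, gaugeTransform γ U = U') ↔
      ∃ k : G, ∀ w : Word d, Word.endpoint x₀ w = x₀ →
        wordHolonomy U' x₀ w = k * wordHolonomy U x₀ w * k⁻¹ := by
  have h := gaugeRelated_on_iff_loops (Set.univ : Set (Edge d L)) x₀
    (fun e _ v _ => (exists_word_endpoint x₀ v).imp fun w hw => ⟨hw, fun l _ => Set.mem_univ l⟩) U U'
  constructor
  · rintro ⟨γ, hγ⟩
    obtain ⟨k, hk⟩ := h.1 ⟨γ, fun e _ => by rw [hγ]⟩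
    exact ⟨k, fun w hw => hk w hw fun l _ => Set.mem_univ l⟩
  · rintro ⟨k, hk⟩
    obtain ⟨γ, hγ⟩ := h.2 ⟨k, fun w hw _ => hk w hw⟩
    exact ⟨γ, funext fun e => hγ e (Set.mem_univ e)⟩

/-- **BASED WILSON LOOPS ARE COMPLETE GAUGE INVARIANTS ON THE FINITE TORUS** (lattice form of
Giles' reconstruction theorem): a gauge-invariant observable takes the same value on two
configurations whose based loop holonomies are simultaneously conjugate. [ours] -/
theorem eq_of_isGaugeInvariant_of_loops_conj [NeZero L] {α : Type*} {F : GaugeConfig d L G → α}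
    (hF : IsGaugeInvariant F) (x₀ : Site d L) {U U' : GaugeConfig d L G} (k : G)
    (hk : ∀ w : Word d, Word.endpoint x₀ w = x₀ →
      wordHolonomy U' x₀ w = k * wordHolonomy U x₀ w * k⁻¹) :
    F U' = F U := by
  obtain ⟨γ, hγ⟩ := (gaugeRelated_iff_loops_univ x₀ U U').2 ⟨k, hk⟩
  rw [← hγ, hF γ U]

/-! ## §4 The marginal over a connected retained set is a function of the joint class -/

variable [TopologicalSpace G] [IsTopologicalGroup G] [CompactSpace G] [MeasurableSpace G]
  [BorelSpace G]

/-- **THE PARTIAL HAAR MARGINAL OVER A CONNECTED RETAINED LINK SET IS A FUNCTION OF THE JOINT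
CONJUGACY CLASS OF ITS BASED LOOP HOLONOMIES.**  If every link off `s` lies in a link set `S`
connected to `x₀`, then for every gauge-invariant `F`, `A_s F (U') = A_s F (U)` whenever one `k`
conjugates the holonomies of all closed words from `x₀` inside `S`. [ours] -/
theorem coordAvg_connected_classFunction [NeZero L] (s : Finset (Edge d L))
    {F : GaugeConfig d L G → ℝ} (hF : IsGaugeInvariant F) (S : Set (Edge d L)) (x₀ : Site d L)
    (hconn : ∀ e ∈ S, ∀ v, v = e.1 ∨ v = e.1.shift e.2 →
      ∃ w : Word d, Word.endpoint x₀ w = v ∧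
        ∀ l ∈ List.zipWith Step.edge (w.scanl Step.apply x₀) w, l ∈ S)
    (hcover : ∀ e, e ∉ s → e ∈ S) {U U' : GaugeConfig d L G} (k : G)
    (hk : ∀ w : Word d, Word.endpoint x₀ w = x₀ →
      (∀ l ∈ List.zipWith Step.edge (w.scanl Step.apply x₀) w, l ∈ S) →
        wordHolonomy U' x₀ w = k * wordHolonomy U x₀ w * k⁻¹) :
    coordAvg (haarProbability G) s F U' = coordAvg (haarProbability G) s F U := by
  obtain ⟨γ, hγ⟩ := (gaugeRelated_on_iff_loops S x₀ hconn U U').2 ⟨k, hk⟩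
  exact coordAvg_eq_of_gaugeRelated_on_cover s hF hcover γ hγ

/-- **… and so is every exact autoregressive conditional**: with the retained sets off `s` and off
`insert a s` inside link sets `S₁ ∋` (everything) and `S₂` connected to `x₀`, simultaneous conjugacy
of the based loop holonomies inside `S₁` (by `k₁`) and inside `S₂` (by `k₂`) forces the same value of
`A_s F / A_{insert a s} F` — the exact conditional of the link `a` reads at most the joint class of the
retained loops through its structure. [ours] -/
theorem arConditional_connected_classFunction [NeZero L] (s : Finset (Edge d L)) (a : Edge d L)
    {F : GaugeConfig d L G → ℝ} (hF : IsGaugeInvariant F) (S₁ S₂ : Set (Edge d L)) (x₀ : Site d L)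
    (hconn₁ : ∀ e ∈ S₁, ∀ v, v = e.1 ∨ v = e.1.shift e.2 →
      ∃ w : Word d, Word.endpoint x₀ w = v ∧
        ∀ l ∈ List.zipWith Step.edge (w.scanl Step.apply x₀) w, l ∈ S₁)
    (hconn₂ : ∀ e ∈ S₂, ∀ v, v = e.1 ∨ v = e.1.shift e.2 →
      ∃ w : Word d, Word.endpoint x₀ w = v ∧
        ∀ l ∈ List.zipWith Step.edge (w.scanl Step.apply x₀) w, l ∈ S₂)
    (hcover₁ : ∀ e, e ∉ s → e ∈ S₁) (hcover₂ : ∀ e, e ∉ insert a s → e ∈ S₂)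
    {U U' : GaugeConfig d L G} (k₁ k₂ : G)
    (hk₁ : ∀ w : Word d, Word.endpoint x₀ w = x₀ →
      (∀ l ∈ List.zipWith Step.edge (w.scanl Step.apply x₀) w, l ∈ S₁) →
        wordHolonomy U' x₀ w = k₁ * wordHolonomy U x₀ w * k₁⁻¹)
    (hk₂ : ∀ w : Word d, Word.endpoint x₀ w = x₀ →
      (∀ l ∈ List.zipWith Step.edge (w.scanl Step.apply x₀) w, l ∈ S₂) →
        wordHolonomy U' x₀ w = k₂ * wordHolonomy U x₀ w * k₂⁻¹) :
    coordAvg (haarProbability G) s F U' / coordAvg (haarProbability G) (insert a s) F U' =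
      coordAvg (haarProbability G) s F U / coordAvg (haarProbability G) (insert a s) F U := by
  rw [coordAvg_connected_classFunction s hF S₁ x₀ hconn₁ hcover₁ k₁ hk₁,
    coordAvg_connected_classFunction (insert a s) hF S₂ x₀ hconn₂ hcover₂ k₂ hk₂]

end Summit.Ventures.LatticeQCDFlow.Theory2.Autoregressive

end
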